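import Literature.IUT.HodgeTheaters.LocalFrobenioidsArchHolSlot
import Literature.IUT.HodgeTheaters.LocalFrobenioidsArchModel
import Literature.IUT.HodgeTheaters.GenuineFKitMergeInputs
import Literature.IUT.HodgeTheaters.ConventionsCatIsomorphismKinds
import Mathlib.CategoryTheory.Functor.FullyFaithful
import HarnessLib

/-!
# [IUTchI] Cor 5.3 (ii) AT THE ARCHIMEDEAN COMPONENT, in the §0 `hker/hlift` shape: both halves DISCHARGED at the
# Rmk 4.1.1-resolution slot `ArchFSlot` — because that slot is EQUIVALENT to its base `EA` (proof-only; row R52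
# «COR53II-ARCH-COMPONENT»)

S. Mochizuki, *Inter-universal Teichmüller theory I*, kurims manuscript (May 2020), §5 Corollary 5.3 (ii) p. 144 l. 14–15
(«the natural map `Isom(¹𝔉, ²𝔉) → Isom(¹𝔇, ²𝔇)` [cf. Remark 5.2.1, (i)] is bijective»), proof p. 144 l. 33–36 («Assertion (ii)
… follows immediately from [AbsTopIII], Proposition 3.2, (iv); [AbsTopIII], Proposition 4.2, (i) [cf. also [AbsTopIII],
Remarks 3.1.1, 4.1.1 …]»); Def 5.2 (i) (b) p. 134 (at `v ∈ 𝕍^arc`, `‡ℱ_v = (‡𝒞_v, ‡𝒟_v, ‡κ_v)`); §0 p. 33 l. 23–24 («we shall refer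
to as an isomorphism `C → D` any isomorphism class of equivalences of categories `C → D`») ([IUTchI] Cor 5.3 (ii) p.144)
[claim: Mochizuki2012, status: disputed] (D-0012 claim key; nothing of the series is asserted; no side taken on [IUTchIII]
Cor. 3.12).  S. Mochizuki, *Topics in absolute anabelian geometry III*, Def 4.1 (iii) p. 103 («the natural functor 𝒞^hol_T → EA»,
`(𝕏 ↶ M) ↦ 𝕏`) and Prop 4.2 (i) p. 105 (a bijection on sets of isomorphisms) [cite: MochizukiAbsTopIII2015, Proposition 4.2 (i) p.105].

PROOF-ONLY (theorems only; 0 `def`, 0 `instance`, 0 notation, no `Prop` fact; cell abc-iut, seat abc-iut-w4-d078 gen 11, L5 ROWS #7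
row R52).  The companion of abc-iut-L5-t4's `Cor53iiAtGoodPlace.lean` (T5, p495336) at the ARCHIMEDEAN component, in the same
§0 currency (abc-iut-L5-t4 `CatIsomorphism.LiesUnder/HasUnder/UnderUnique/descend/DescendBijective`, p491065;
`descend_injective_of_kernel_trivial`, p492186; racer B's `CatIsomorphism.RigidOverBase/KernelRigid/LiftsAll/liftKindToAmb`,
p495677), over abc-iut-L4-t14's candidate archimedean slot `ArchFSlot 𝔄 K_v` with base functor `ArchFSlot.toEA` (p493659) and
abc-iut-w5-d226's `HolMonoidPair.toEA_isEquivalence` ([AbsTopIII] Prop 4.2 (i) at the model).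

* §0 GENERIC (pure category theory).  For a structure functor `p : C ⥤ B` that is FULL and FAITHFUL: every self-equivalence
  `Ψ` of `C` lying under `𝟭_B` is `≅ 𝟭_C` (`nonempty_iso_id_of_liesUnder_refl`, Mathlib `Functor.fullyFaithfulCancelRight`) —
  T5's `hker`, B's `RigidOverBase p` / `KernelRigid p`.  For `p` an EQUIVALENCE: the §0 natural map's binders `HasUnder p p`,
  `UnderUnique p p` hold and every self-equivalence of `B` lifts (`hlift`), so `descend` is bijective
  (`descendBijective_of_isEquivalence`).
* §1 AT `𝒞^hol_T → EA` (`T ∈ {TM, TLG, TCG}`): an equivalence by name ⇒ `DescendBijective` unconditional.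
* §2 AT THE ARCHIMEDEAN ℱ-SLOT `ArchFSlot 𝔄 K_v`: `toEA` is FULL and FAITHFUL (so `hker` / `RigidOverBase` / `KernelRigid` hold
  OUTRIGHT), and — given ONE Ex 3.4 (i) datum `X₀ : ArchLocalFrobenioid K_v` (DATA; over `ℂ` abc-iut-L5-t2's
  `ArchLocalFrobenioid.ofArchFrd`) — ESSENTIALLY SURJECTIVE (a presentation exists over every `D ∈ Ob(EA)`), hence an
  EQUIVALENCE `ArchFSlot 𝔄 K_v ≌ EA`; therefore `hlift`, `HasUnder`, `UnderUnique` hold and **Cor 5.3 (ii)'s archimedean model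
  case `DescendBijective (toEA) (toEA) he hu` holds for every choice of the binders** (`ArchFSlot.descendBijective_toEA`; over `ℂ`
  with no datum hypothesis, `…_complex`).  In racer B's lift-kind currency the arch slot's model case reduces to `LiftsAll` alone.

HONEST LABEL.  The equivalence `ArchFSlot ≌ EA` is abc-iut-L4-t14's «HONEST LIMITS» paragraph (p493659) made quantitative: at
the [AbsTopIII] Rmk 4.1.1 resolution the archimedean ℱ-slot carries no information beyond `𝒟_v` (`‡𝒞_v` rides along through
`𝒪^⊳(‡𝒞_v)` only), so Cor 5.3 (ii)-arch THERE is a theorem about OUR slot, not evidence for print's sentence; the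
non-tautological archimedean statement lives at the [FrdII] Ex 3.3 archimedean-Frobenioid refinement (layer L1), which would map
to this slot.  Binder census of the §2 headlines: LAW 0 · FACT 0 · DATA {𝔄, K_v, X₀} (none over `ℂ`).  Typed ≠ inhabited ≠
proved; nothing here asserts abc proved or refuted.
-/

namespace Literature.IUT.HodgeTheaters

open CategoryTheory Literature.AnabelianGeometry.AbsoluteAnabelian

universe v₁ v₂ u₁ u₂ u

/-! ### §0. Generic: full and faithful structure functors are kernel-rigid; equivalences descend bijectively -/

namespace CatIsomorphism

section FullFaithful

variable {C : Type u₁} [Category.{v₁} C] {B : Type u₂} [Category.{v₂} B] (p : C ⥤ B)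

/-- **`hker` for a FULL and FAITHFUL structure functor**: a self-equivalence `Ψ` of `C` lying under the identity of `B`
(`Ψ ⋙ p ≅ p ⋙ 𝟭`) is isomorphic to `𝟭_C` — cancel `p` on the right (Mathlib `Functor.fullyFaithfulCancelRight`).  This is
the hypothesis `hker` of abc-iut-L5-t4's `descend_injective_of_kernel_trivial` / T5. ([IUTchI] Cor 5.3 (ii) p.144)
[claim: Mochizuki2012, status: disputed] -/
theorem nonempty_iso_id_of_liesUnder_refl [p.Full] [p.Faithful] (Ψ : C ≌ C)
    (h : Nonempty (LiesUnder p p Ψ (CategoryTheory.Equivalence.refl (C := B)))) : Nonempty (Ψ.functor ≅ 𝟭 C) := by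
  obtain ⟨h⟩ := h
  exact ⟨Functor.fullyFaithfulCancelRight p (h ≪≫ p.rightUnitor ≪≫ p.leftUnitor.symm)⟩

/-- **Racer B's `RigidOverBase p` holds for every full and faithful `p`.** ([IUTchI] Cor 5.3 (ii) p.144)
[claim: Mochizuki2012, status: disputed] -/
theorem rigidOverBase_of_full_faithful [p.Full] [p.Faithful] : RigidOverBase p :=
  fun Ψ h => nonempty_iso_id_of_liesUnder_refl p Ψ h

/-- **… and so does `KernelRigid p`** (B's `kernelRigid_iff_rigidOverBase`). ([IUTchI] Cor 5.3 (ii) p.144)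
[claim: Mochizuki2012, status: disputed] -/
theorem kernelRigid_of_full_faithful [p.Full] [p.Faithful] : KernelRigid p :=
  kernelRigid_iff_rigidOverBase.mpr (rigidOverBase_of_full_faithful p)

/-- For ANY binders `he`/`hu` of the §0 natural map, `descend : Aut(C) → Aut(B)` is INJECTIVE when `p` is full and faithful
(abc-iut-L5-t4 `descend_injective_of_kernel_trivial` fed by `hker` above). ([IUTchI] Cor 5.3 (ii) p.144)
[claim: Mochizuki2012, status: disputed] -/
theorem descend_injective_of_full_faithful [p.Full] [p.Faithful] (he : HasUnder p p) (hu : UnderUnique p p) :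
    Function.Injective (descend he hu) :=
  descend_injective_of_kernel_trivial he hu fun Ψ h => nonempty_iso_id_of_liesUnder_refl p Ψ h

end FullFaithful

section IsEquivalence

variable {C : Type u₁} [Category.{v₁} C] {B : Type u₂} [Category.{v₂} B] (p : C ⥤ B) [p.IsEquivalence]

/-- Under an EQUIVALENCE `p`, the self-equivalence `p⁻¹ ∘ Ψ ∘ p` of `B` lies under `Ψ`. ([IUTchI] Cor 5.3 (ii) p.144)
[claim: Mochizuki2012, status: disputed] -/
theorem nonempty_liesUnder_conj (Ψ : C ≌ C) :
    Nonempty (LiesUnder p p Ψ (p.asEquivalence.symm.trans (Ψ.trans p.asEquivalence))) := by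
  refine ⟨?_⟩
  change Ψ.functor ⋙ p ≅ p ⋙ (p.asEquivalence.inverse ⋙ (Ψ.functor ⋙ p))
  exact (Functor.leftUnitor _).symm ≪≫ Functor.isoWhiskerRight p.asEquivalence.unitIso (Ψ.functor ⋙ p) ≪≫
    Functor.associator _ _ _

/-- **`HasUnder p p` for an equivalence** (the binder `he` of the §0 natural map, DISCHARGED). ([IUTchI] Cor 5.3 (ii) p.144)
[claim: Mochizuki2012, status: disputed] -/
theorem hasUnder_of_isEquivalence : HasUnder p p :=
  fun Ψ => ⟨_, nonempty_liesUnder_conj p Ψ⟩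

/-- **`UnderUnique p p` for an equivalence** (the binder `hu`, DISCHARGED): cancel `p` on the left through `p⁻¹ ⋙ p ≅ 𝟭`.
([IUTchI] Cor 5.3 (ii) p.144) [claim: Mochizuki2012, status: disputed] -/
theorem underUnique_of_isEquivalence : UnderUnique p p := by
  intro Ψ Θ Θ' h h'
  obtain ⟨h⟩ := h
  obtain ⟨h'⟩ := h'
  -- `p ⋙ Θ ≅ Ψ ⋙ p ≅ p ⋙ Θ'`, whiskered by `p⁻¹` on the left and un-whiskered through the counit
  have k : p ⋙ Θ.functor ≅ p ⋙ Θ'.functor := h.symm ≪≫ h'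
  exact ⟨(Functor.leftUnitor _).symm ≪≫ Functor.isoWhiskerRight p.asEquivalence.counitIso.symm Θ.functor ≪≫
    Functor.associator _ _ _ ≪≫ Functor.isoWhiskerLeft p.asEquivalence.inverse k ≪≫ (Functor.associator _ _ _).symm ≪≫
    Functor.isoWhiskerRight p.asEquivalence.counitIso Θ'.functor ≪≫ Functor.leftUnitor _⟩

/-- **`hlift` for an equivalence**: every self-equivalence `Θ` of `B` has `p ∘ Θ ∘ p⁻¹` over it. ([IUTchI] Cor 5.3 (ii) p.144)
[claim: Mochizuki2012, status: disputed] -/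
theorem lifts_of_isEquivalence (Θ : B ≌ B) : ∃ Ψ : C ≌ C, Nonempty (LiesUnder p p Ψ Θ) := by
  refine ⟨p.asEquivalence.trans (Θ.trans p.asEquivalence.symm), ⟨?_⟩⟩
  change (p ⋙ (Θ.functor ⋙ p.asEquivalence.inverse)) ⋙ p ≅ p ⋙ Θ.functor
  exact Functor.associator _ _ _ ≪≫ Functor.isoWhiskerLeft p (Functor.associator _ _ _ ≪≫
    Functor.isoWhiskerLeft Θ.functor p.asEquivalence.counitIso ≪≫ Θ.functor.rightUnitor)

/-- **For an EQUIVALENCE `p` the §0 natural map `descend : Aut(C) → Aut(B)` is BIJECTIVE, for every choice of the binders.**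
([IUTchI] Cor 5.3 (ii) p.144) [claim: Mochizuki2012, status: disputed] -/
theorem descendBijective_of_isEquivalence (he : HasUnder p p) (hu : UnderUnique p p) : DescendBijective p p he hu :=
  ⟨descend_injective_of_full_faithful p he hu, descend_surjective_of_lifts he hu (lifts_of_isEquivalence p)⟩

end IsEquivalence

end CatIsomorphism

/-! ### §1. At [AbsTopIII] Def 4.1 (iii)'s `𝒞^hol_T → EA` -/

namespace HolMonoidPairCor53

variable {𝔄 : AutHolFieldFunctor.{u}} {T : ArchPairType}

/-- **[AbsTopIII] Prop 4.2 (i) in §0 currency**: since `(𝕏 ↶ M) ↦ 𝕏` is an equivalence `𝒞^hol_T ≌ EA` (abc-iut-w5-d226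
`HolMonoidPair.toEA_isEquivalence`), the §0 natural map `Aut(𝒞^hol_T) → Aut(EA)` is bijective for every choice of binders.
[cite: MochizukiAbsTopIII2015, Proposition 4.2 (i) p.105] -/
theorem descendBijective_toEA (hT : T.IsMonoidType)
    (he : CatIsomorphism.HasUnder (HolMonoidPair.toEA 𝔄 T) (HolMonoidPair.toEA 𝔄 T))
    (hu : CatIsomorphism.UnderUnique (HolMonoidPair.toEA 𝔄 T) (HolMonoidPair.toEA 𝔄 T)) :
    CatIsomorphism.DescendBijective (HolMonoidPair.toEA 𝔄 T) (HolMonoidPair.toEA 𝔄 T) he hu := by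
  haveI := HolMonoidPair.toEA_isEquivalence (𝔄 := 𝔄) hT
  exact CatIsomorphism.descendBijective_of_isEquivalence _ he hu

/-- The binders exist: `HasUnder` ∧ `UnderUnique` at `𝒞^hol_T → EA`. [cite: MochizukiAbsTopIII2015, Proposition 4.2 (i) p.105] -/
theorem hasUnder_underUnique_toEA (hT : T.IsMonoidType) :
    CatIsomorphism.HasUnder (HolMonoidPair.toEA 𝔄 T) (HolMonoidPair.toEA 𝔄 T) ∧
      CatIsomorphism.UnderUnique (HolMonoidPair.toEA 𝔄 T) (HolMonoidPair.toEA 𝔄 T) := by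
  haveI := HolMonoidPair.toEA_isEquivalence (𝔄 := 𝔄) hT
  exact ⟨CatIsomorphism.hasUnder_of_isEquivalence _, CatIsomorphism.underUnique_of_isEquivalence _⟩

end HolMonoidPairCor53

/-! ### §2. At the archimedean ℱ-slot `ArchFSlot 𝔄 K_v` of [IUTchI] Def 5.2 (i) (b) (Rmk 4.1.1 resolution) -/

namespace ArchFSlot

variable (𝔄 : AutHolFieldFunctor.{u}) (Kv : Type u) [NormedField Kv] [NormedAlgebra ℝ Kv]

/-- `‡ℱ_v ↦ ‡𝒟_v` is FULL: `‡ℱ_v ↦ (‡𝒟_v ↶ 𝒪^⊳(‡𝒞_v))` is fully faithful by construction of the slot and `(𝕏 ↶ M) ↦ 𝕏` is full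
([AbsTopIII] Prop 4.2 (i): every finite étale morphism lifts, `HolMonoidPair.Hom.ofBase`). ([IUTchI] Def 5.2 (i) p.134)
[claim: Mochizuki2012, status: disputed] -/
theorem toEA_full : (ArchFSlot.toEA 𝔄 Kv).Full := by
  haveI := HolMonoidPair.toEA_isEquivalence (𝔄 := 𝔄) ArchPairType.isMonoidType_TM
  exact Functor.Full.comp _ _

/-- `‡ℱ_v ↦ ‡𝒟_v` is FAITHFUL (a morphism of pairs is determined by its structure part, `HolMonoidPair.Hom.ext_of_base`).
([IUTchI] Def 5.2 (i) p.134) [claim: Mochizuki2012, status: disputed] -/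
theorem toEA_faithful : (ArchFSlot.toEA 𝔄 Kv).Faithful := by
  haveI := HolMonoidPair.toEA_isEquivalence (𝔄 := 𝔄) ArchPairType.isMonoidType_TM
  exact Functor.Faithful.comp _ _

/-- **`hker` AT THE ARCHIMEDEAN SLOT, UNCONDITIONAL**: every self-equivalence of `ArchFSlot 𝔄 K_v` lying under the identity of
`EA` is isomorphic to the identity. ([IUTchI] Cor 5.3 (ii) p.144) [claim: Mochizuki2012, status: disputed] -/
theorem hker_toEA (Ψ : ArchFSlot 𝔄 Kv ≌ ArchFSlot 𝔄 Kv)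
    (h : Nonempty (CatIsomorphism.LiesUnder (ArchFSlot.toEA 𝔄 Kv) (ArchFSlot.toEA 𝔄 Kv) Ψ
      (CategoryTheory.Equivalence.refl (C := 𝔄.EA)))) :
    Nonempty (Ψ.functor ≅ 𝟭 (ArchFSlot 𝔄 Kv)) := by
  haveI := toEA_full 𝔄 Kv
  haveI := toEA_faithful 𝔄 Kv
  exact CatIsomorphism.nonempty_iso_id_of_liesUnder_refl _ Ψ h

/-- **Racer B's `RigidOverBase` at the archimedean slot, UNCONDITIONAL.** ([IUTchI] Cor 5.3 (ii) p.144)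
[claim: Mochizuki2012, status: disputed] -/
theorem rigidOverBase_toEA : CatIsomorphism.RigidOverBase (ArchFSlot.toEA 𝔄 Kv) :=
  fun Ψ h => hker_toEA 𝔄 Kv Ψ h

/-- **Racer B's `KernelRigid` at the archimedean slot, UNCONDITIONAL.** ([IUTchI] Cor 5.3 (ii) p.144)
[claim: Mochizuki2012, status: disputed] -/
theorem kernelRigid_toEA : CatIsomorphism.KernelRigid (ArchFSlot.toEA 𝔄 Kv) :=
  CatIsomorphism.kernelRigid_iff_rigidOverBase.mpr (rigidOverBase_toEA 𝔄 Kv)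

/-- **INJECTIVITY of the §0 natural map `Aut(ℱ-slot) → Aut(EA)` at the archimedean slot, for ANY binders** (T5 §1 shape).
([IUTchI] Cor 5.3 (ii) p.144) [claim: Mochizuki2012, status: disputed] -/
theorem descend_injective_toEA
    (he : CatIsomorphism.HasUnder (ArchFSlot.toEA 𝔄 Kv) (ArchFSlot.toEA 𝔄 Kv))
    (hu : CatIsomorphism.UnderUnique (ArchFSlot.toEA 𝔄 Kv) (ArchFSlot.toEA 𝔄 Kv)) :
    Function.Injective (CatIsomorphism.descend he hu) := by
  haveI := toEA_full 𝔄 Kv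
  haveI := toEA_faithful 𝔄 Kv
  exact CatIsomorphism.descend_injective_of_full_faithful _ he hu

/-- **In racer B's lift-kind currency**: at an archimedean ℱ-slot read through `toEA` into ANY ambient `A ∋ a` by ANY
`ρ : Aut a →* Aut(EA)`, the model case «`α ↦ toD(α)` bijective» is EQUIVALENT to `LiftsAll` alone (the kernel half being
discharged). ([IUTchI] Cor 5.3 (ii) p.144) [claim: Mochizuki2012, status: disputed] -/
theorem mapIso_liftKindToAmb_bijective_iff_liftsAll {A : Type u₁} [Category.{v₁} A] (a : A) (ρ : Aut a →* CatAut 𝔄.EA) :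
    Function.Bijective (fun α : SingleObj.star ↥(CatIsomorphism.liftSubgroup (ArchFSlot.toEA 𝔄 Kv) a ρ) ≅
        SingleObj.star ↥(CatIsomorphism.liftSubgroup (ArchFSlot.toEA 𝔄 Kv) a ρ) =>
        (show a ≅ a from (CatIsomorphism.liftKindToAmb (ArchFSlot.toEA 𝔄 Kv) a ρ).mapIso α)) ↔
      CatIsomorphism.LiftsAll (ArchFSlot.toEA 𝔄 Kv) a ρ := by
  rw [CatIsomorphism.mapIso_liftKindToAmb_bijective_iff]
  exact ⟨fun h => h.1, fun h => ⟨h, kernelRigid_toEA 𝔄 Kv⟩⟩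

/-- **A presentation exists OVER EVERY `D ∈ Ob(EA)`** (on the nose): `𝒜_{𝒟_v}` and `𝒜_D` are CAFs, identified through `ℂ`
(abc-iut-L4-t14's `nonempty_holPresentation`, with the base object pinned). ([IUTchI] Ex 3.4 (i) p.80)
[claim: Mochizuki2012, status: disputed] -/
theorem exists_holPresentation_D_eq (X : ArchLocalFrobenioid.{u} Kv) (D : 𝔄.EA) :
    ∃ π : X.HolPresentation 𝔄, π.D = D := by
  obtain ⟨e, he, he'⟩ := X.caf
  obtain ⟨f, hf, hf'⟩ := (𝔄.isCAF D).exists_equiv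
  exact ⟨⟨D, e.trans f.symm, hf'.comp he, he'.comp hf⟩, rfl⟩

/-- `‡ℱ_v ↦ ‡𝒟_v` is ESSENTIALLY SURJECTIVE as soon as ONE Ex 3.4 (i) datum `X₀` exists (present `X₀` over the given `D`).
([IUTchI] Def 5.2 (i) p.134) [claim: Mochizuki2012, status: disputed] -/
theorem toEA_essSurj (X₀ : ArchLocalFrobenioid.{u} Kv) : (ArchFSlot.toEA 𝔄 Kv).EssSurj where
  mem_essImage D := by
    obtain ⟨π, hπ⟩ := exists_holPresentation_D_eq 𝔄 Kv X₀ D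
    exact ⟨(⟨X₀, π⟩ : ArchFData 𝔄 Kv), ⟨eqToIso hπ⟩⟩

/-- **`‡ℱ_v ↦ ‡𝒟_v` IS AN EQUIVALENCE `ArchFSlot 𝔄 K_v ≌ EA`** (given one Ex 3.4 (i) datum): at the Rmk 4.1.1 resolution the
archimedean ℱ-slot carries no information beyond its base — abc-iut-L4-t14's «HONEST LIMITS» made quantitative.
([IUTchI] Def 5.2 (i) p.134) [claim: Mochizuki2012, status: disputed] -/
theorem toEA_isEquivalence (X₀ : ArchLocalFrobenioid.{u} Kv) : (ArchFSlot.toEA 𝔄 Kv).IsEquivalence := by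
  haveI := toEA_full 𝔄 Kv
  haveI := toEA_faithful 𝔄 Kv
  haveI := toEA_essSurj 𝔄 Kv X₀
  exact {}

/-- The §0 natural map's binders at the archimedean slot, DISCHARGED (given one datum). ([IUTchI] Cor 5.3 (ii) p.144)
[claim: Mochizuki2012, status: disputed] -/
theorem hasUnder_underUnique_toEA (X₀ : ArchLocalFrobenioid.{u} Kv) :
    CatIsomorphism.HasUnder (ArchFSlot.toEA 𝔄 Kv) (ArchFSlot.toEA 𝔄 Kv) ∧
      CatIsomorphism.UnderUnique (ArchFSlot.toEA 𝔄 Kv) (ArchFSlot.toEA 𝔄 Kv) := by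
  haveI := toEA_isEquivalence 𝔄 Kv X₀
  exact ⟨CatIsomorphism.hasUnder_of_isEquivalence _, CatIsomorphism.underUnique_of_isEquivalence _⟩

/-- **`hlift` AT THE ARCHIMEDEAN SLOT** (given one datum): every self-equivalence of `EA` has a self-equivalence of the slot
over it. ([IUTchI] Cor 5.3 (ii) p.144) [claim: Mochizuki2012, status: disputed] -/
theorem hlift_toEA (X₀ : ArchLocalFrobenioid.{u} Kv) (Θ : 𝔄.EA ≌ 𝔄.EA) :
    ∃ Ψ : ArchFSlot 𝔄 Kv ≌ ArchFSlot 𝔄 Kv,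
      Nonempty (CatIsomorphism.LiesUnder (ArchFSlot.toEA 𝔄 Kv) (ArchFSlot.toEA 𝔄 Kv) Ψ Θ) := by
  haveI := toEA_isEquivalence 𝔄 Kv X₀
  exact CatIsomorphism.lifts_of_isEquivalence _ Θ

/-- **[IUTchI] Cor 5.3 (ii), ARCHIMEDEAN MODEL CASE in the §0 `hker/hlift` shape — both halves DISCHARGED**: for every choice of
the binders `he`/`hu`, the natural map `Aut(ArchFSlot 𝔄 K_v) → Aut(EA)` is bijective (given one Ex 3.4 (i) datum `X₀`).
A theorem about OUR slot at the Rmk 4.1.1 resolution (see the module docstring's HONEST LABEL), not evidence for print.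
([IUTchI] Cor 5.3 (ii) p.144) [claim: Mochizuki2012, status: disputed] -/
theorem descendBijective_toEA (X₀ : ArchLocalFrobenioid.{u} Kv)
    (he : CatIsomorphism.HasUnder (ArchFSlot.toEA 𝔄 Kv) (ArchFSlot.toEA 𝔄 Kv))
    (hu : CatIsomorphism.UnderUnique (ArchFSlot.toEA 𝔄 Kv) (ArchFSlot.toEA 𝔄 Kv)) :
    CatIsomorphism.DescendBijective (ArchFSlot.toEA 𝔄 Kv) (ArchFSlot.toEA 𝔄 Kv) he hu := by
  haveI := toEA_isEquivalence 𝔄 Kv X₀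
  exact CatIsomorphism.descendBijective_of_isEquivalence _ he hu

/-- **Group-homomorphism form** («the natural homomorphism `Aut(ℱ-slot) → Aut(EA)`», abc-iut-L5-t4 `descendHom`): bijective,
for every choice of binders, given one Ex 3.4 (i) datum. ([IUTchI] Cor 5.3 (ii) p.144) [claim: Mochizuki2012, status: disputed] -/
theorem descendHom_bijective_toEA (X₀ : ArchLocalFrobenioid.{u} Kv)
    (he : CatIsomorphism.HasUnder (ArchFSlot.toEA 𝔄 Kv) (ArchFSlot.toEA 𝔄 Kv))
    (hu : CatIsomorphism.UnderUnique (ArchFSlot.toEA 𝔄 Kv) (ArchFSlot.toEA 𝔄 Kv)) :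
    Function.Bijective (CatIsomorphism.descendHom he hu) :=
  (CatIsomorphism.descendHom_bijective_iff he hu).mpr (descendBijective_toEA 𝔄 Kv X₀ he hu)

end ArchFSlot

/-! ### §3. Over `ℂ`: no datum hypothesis (abc-iut-L5-t2's `ArchLocalFrobenioid.ofArchFrd`) -/

namespace ArchFSlot

variable (𝔄 : AutHolFieldFunctor.{0})

/-- Over `K_v = ℂ` the slot `ArchFSlot 𝔄 ℂ → EA` is an equivalence OUTRIGHT (datum: abc-iut-L5-t2's model `ofArchFrd`).
([IUTchI] Ex 3.4 (i) p.80) [claim: Mochizuki2012, status: disputed] -/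
theorem toEA_isEquivalence_complex : (ArchFSlot.toEA 𝔄 ℂ).IsEquivalence :=
  toEA_isEquivalence 𝔄 ℂ ArchLocalFrobenioid.ofArchFrd

/-- **[IUTchI] Cor 5.3 (ii), archimedean model case over `ℂ`, §0 shape, NO hypothesis beyond the binders' names.**
([IUTchI] Cor 5.3 (ii) p.144) [claim: Mochizuki2012, status: disputed] -/
theorem descendBijective_toEA_complex
    (he : CatIsomorphism.HasUnder (ArchFSlot.toEA 𝔄 ℂ) (ArchFSlot.toEA 𝔄 ℂ))
    (hu : CatIsomorphism.UnderUnique (ArchFSlot.toEA 𝔄 ℂ) (ArchFSlot.toEA 𝔄 ℂ)) :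
    CatIsomorphism.DescendBijective (ArchFSlot.toEA 𝔄 ℂ) (ArchFSlot.toEA 𝔄 ℂ) he hu :=
  descendBijective_toEA 𝔄 ℂ ArchLocalFrobenioid.ofArchFrd he hu

/-- NON-VACUITY of the binders over `ℂ`: they are inhabited. ([IUTchI] Cor 5.3 (ii) p.144) [claim: Mochizuki2012, status: disputed] -/
theorem hasUnder_underUnique_toEA_complex :
    CatIsomorphism.HasUnder (ArchFSlot.toEA 𝔄 ℂ) (ArchFSlot.toEA 𝔄 ℂ) ∧
      CatIsomorphism.UnderUnique (ArchFSlot.toEA 𝔄 ℂ) (ArchFSlot.toEA 𝔄 ℂ) :=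
  hasUnder_underUnique_toEA 𝔄 ℂ ArchLocalFrobenioid.ofArchFrd

end ArchFSlot

end Literature.IUT.HodgeTheaters
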